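import Literature.NumberTheory.EllipticCurves.HeegnerPointsClassesProofs
import Literature.NumberTheory.QuadraticFields.FormIdealsStructure
import HarnessLib

/-!
# Heegner forms and ideal classes, I: `τ_Q` determines `Q`; `SL₂(ℤ)`-equivalent forms give
# equivalent ideals

Companion (theorems only) to `Literature.NumberTheory.EllipticCurves.HeegnerPoints`, first of three
files proving the named fact `Literature.NumberTheory.EllipticCurves.HeegnerDatum.card_reps_eq_classNumber`
(`#reps = h(K)`: the `Γ₀(N)`-classes of Heegner forms `(A, B, C)` of level `N`, discriminant `d_K`,
`B ≡ β (mod 2N)` are in bijection with `Cl(K)` via `(A, B, C) ↦ [𝔞]`, `𝔞 = ℤA + ℤ(−B + √d_K)/2`;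
Gross, *Heegner points on `X₀(N)`* (1984), §I.1; Gross–Kohnen–Zagier 1987, §I.1, p. 504–505).
With an integral basis `(1, ω)` of `𝓞 K`, `ω² = m + tω`, `d_K = t² + 4m`
(`Literature.NumberTheory.QuadraticFields.Quadratic.exists_basis_zero_eq_one`), the ideal of
`Q = (A, B, C)` is `𝔞_Q = (A, ω − k)`, `k = (B + t)/2` (`FormIdeals.lean`). Here:

* `two_mul_ediv_two_of_disc_eq`, `norm_eq_of_disc_eq`: `B ≡ t (mod 2)` and `AC = k² − tk − m`
  for a form of discriminant `t² + 4m`;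
* `heegnerForm_eq_of_heegnerTau_eq`: two positive definite forms with the same discriminant and the same
  Heegner point `τ_Q ∈ ℍ` are equal (`Im τ_Q = √|D|/2A`, `Re τ_Q = −B/2A`);
* `det_eq_one_of_moebius_eq`: if `τ = (pτ' + q)/(rτ' + s)` for `τ, τ' ∈ ℍ` and `ps − qr = ±1`
  then `ps − qr = 1`;
* `sl2_formIdeal_eq` (**the lattice computation behind `SL₂(ℤ)`-invariance**, Cox §7.B,
  proof of Thm. 7.7(ii), (7.10): `[1, gτ] = (rτ + s)⁻¹[1, τ]`): for `g = (p q; r s) ∈ SL₂(ℤ)` and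
  the form `Q'' = (A'', B'', C'')` with `g · τ_Q = τ_{Q''}` (`sl2_smul_heegnerTau`),
  `(A'') · 𝔞_Q = (μ) · 𝔞_{Q''}` with `μ = r(ω − k) + sA = A(rτ_Q + s)`;
* `exists_span_mul_formIdeal_eq_of_isGamma0Equiv`: hence `Γ₀(N)`-equivalent Heegner forms
  (`IsGamma0Equiv`, through their points in `ℍ`) have ideals in the same class, in the form
  `(x) 𝔞_Q = (y) 𝔞_{Q'}`, `x, y ≠ 0` (Mathlib `ClassGroup.mk0_eq_mk0_iff`).

## References

* B. H. Gross, *Heegner points on `X₀(N)`*, in *Modular Forms* (Durham 1983), Horwood (1984),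
  87–105, §I.1.
* B. Gross, W. Kohnen, D. Zagier, *Heegner points and derivatives of `L`-series. II*, Math. Ann.
  278 (1987), 497–562, §I.1.
* D. A. Cox, *Primes of the form x² + ny²*, 2nd ed., Wiley (2013), §7.B, Thm. 7.7 and (7.8)–(7.10).
-/

noncomputable section

open scoped MatrixGroups

open Module NumberField CongruenceSubgroup UpperHalfPlane
open Literature.NumberTheory.QuadraticFields.Quadratic

namespace Literature.NumberTheory.EllipticCurves

/-! ### Arithmetic of a form of discriminant `t² + 4m` -/

/-- If `B² − 4AC = t² + 4m` then `B ≡ t (mod 2)`: `2 · ((B + t)/2) = B + t`. [folklore] -/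
theorem two_mul_ediv_two_of_disc_eq {A B C t m : ℤ} (h : B ^ 2 - 4 * A * C = t ^ 2 + 4 * m) :
    2 * ((B + t) / 2) = B + t := by
  have h2 : (2 : ℤ) ∣ B + t := by
    have hprod : (2 : ℤ) ∣ (B - t) * (B + t) := ⟨2 * (A * C + m), by linear_combination h⟩
    rcases Int.prime_two.dvd_or_dvd hprod with h1 | h1
    · have : B + t = (B - t) + 2 * t := by ring
      rw [this]
      exact dvd_add h1 (dvd_mul_right 2 t)
    · exact h1
  obtain ⟨c, hc⟩ := h2
  omega

/-- If `B² − 4AC = t² + 4m` and `B = 2k − t` then `AC = k² − tk − m` (the norm condition making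
`(A, ω − k)` a lattice ideal, `FormIdeals`). [folklore] -/
theorem norm_eq_of_disc_eq {A B C t m k : ℤ} (h : B ^ 2 - 4 * A * C = t ^ 2 + 4 * m)
    (hk : 2 * k = B + t) : A * C = k ^ 2 - t * k - m := by
  have hB : B = 2 * k - t := by linarith
  subst hB
  nlinarith [h]

/-! ### `τ_Q` determines `Q` among forms of the same discriminant -/

/-- **The Heegner point determines the form.** Two positive definite forms `Q = (A, B, C)`,
`Q' = (A', B', C')` (`A, A' > 0`) with the same (negative) discriminant and the same point
`τ_Q = τ_{Q'} ∈ ℍ` coincide: `Im τ = √|D|/(2A)` gives `A = A'`, `Re τ = −B/(2A)` gives `B = B'`,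
and the discriminant gives `C = C'` (Gross–Kohnen–Zagier 1987, §I.1: `Q ↦ τ_Q` identifies classes
of forms with Heegner points). [folklore] -/
theorem heegnerForm_eq_of_heegnerTau_eq {Q Q' : ℤ × ℤ × ℤ} (hA : 0 < Q.1) (hD : Q.2.1 ^ 2 - 4 * Q.1 * Q.2.2 < 0)
    (hA' : 0 < Q'.1) (hdisc : Q.2.1 ^ 2 - 4 * Q.1 * Q.2.2 = Q'.2.1 ^ 2 - 4 * Q'.1 * Q'.2.2)
    (hτ : heegnerTau Q = heegnerTau Q') : Q = Q' := by
  obtain ⟨A, B, C⟩ := Q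
  obtain ⟨A', B', C'⟩ := Q'
  dsimp only at hA hD hA' hdisc ⊢
  have hD' : B' ^ 2 - 4 * A' * C' < 0 := hdisc ▸ hD
  have h := congrArg (fun z : ℍ ↦ (z : ℂ)) hτ
  rw [coe_heegnerTau (Q := (A, B, C)) hA hD, coe_heegnerTau (Q := (A', B', C')) hA' hD'] at h
  have hre := congrArg Complex.re h
  have him := congrArg Complex.im h
  simp only at hre him
  have hAR : (0 : ℝ) < A := by exact_mod_cast hA
  have hAR' : (0 : ℝ) < A' := by exact_mod_cast hA'
  have hnegR : (0 : ℝ) < 4 * A * C - B ^ 2 := by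
    have : ((B ^ 2 - 4 * A * C : ℤ) : ℝ) < 0 := by exact_mod_cast hD
    push_cast at this
    linarith
  have hdiscR : (4 * (A : ℝ) * C - B ^ 2) = 4 * A' * C' - B' ^ 2 := by
    have : ((B ^ 2 - 4 * A * C : ℤ) : ℝ) = B' ^ 2 - 4 * A' * C' := by exact_mod_cast hdisc
    push_cast at this
    linarith
  -- `A = A'` from the imaginary parts
  have hAA : A = A' := by
    rw [← hdiscR] at him
    have hs : 0 < √(4 * (A : ℝ) * C - B ^ 2) := Real.sqrt_pos.mpr hnegR
    rw [div_eq_div_iff (by positivity) (by positivity)] at him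
    have h2 : (2 * (A' : ℝ)) = 2 * A := mul_left_cancel₀ hs.ne' him
    exact_mod_cast (by linarith : (A : ℝ) = A')
  subst hAA
  -- `B = B'` from the real parts
  have hBB : B = B' := by
    rw [div_eq_div_iff (by positivity) (by positivity)] at hre
    have h2 : (-(B : ℝ)) = -B' := mul_right_cancel₀ (by positivity : (2 * (A : ℝ)) ≠ 0) hre
    exact_mod_cast (by linarith : (B : ℝ) = B')
  subst hBB
  -- `C = C'` from the discriminants
  have hCC : C = C' := by
    have : 4 * A * C = 4 * A * C' := by linarith
    have hA0 : (4 * A : ℤ) ≠ 0 := by positivity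
    exact mul_left_cancel₀ hA0 (by linarith)
  rw [hCC]

/-! ### Möbius transformations between points of `ℍ` have determinant `+1` -/

/-- If `τ (rτ' + s) = pτ' + q` for `τ, τ' ∈ ℍ` and integers with `ps − qr = ±1`, then
`ps − qr = 1`: `Im τ · |rτ' + s|² = (ps − qr) Im τ'` (orientation; the lattice bases
`(A, ω − k)` are positively oriented). [folklore] -/
theorem det_eq_one_of_moebius_eq {τ τ' : ℍ} {p q r s : ℤ}
    (h : (τ : ℂ) * ((r : ℂ) * τ' + s) = (p : ℂ) * τ' + q)
    (hdet : p * s - q * r = 1 ∨ p * s - q * r = -1) : p * s - q * r = 1 := by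
  rcases hdet with hdet | hdet
  · exact hdet
  exfalso
  set x : ℝ := (τ' : ℂ).re with hx
  set y : ℝ := (τ' : ℂ).im with hy
  set u : ℝ := (τ : ℂ).re with hu
  set v : ℝ := (τ : ℂ).im with hv
  have hy0 : 0 < y := τ'.im_pos
  have hv0 : 0 < v := τ.im_pos
  have hre := congrArg Complex.re h
  have him := congrArg Complex.im h
  simp only [Complex.mul_re, Complex.mul_im, Complex.add_re, Complex.add_im, Complex.intCast_re,
    Complex.intCast_im, zero_mul, sub_zero, add_zero] at hre him
  rw [← hx, ← hy, ← hu, ← hv] at hre him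
  -- `v · ((rx + s)² + (ry)²) = (ps - qr) y`
  have key : v * ((r * x + s) ^ 2 + (r * y) ^ 2) = (p * s - q * r : ℝ) * y := by
    linear_combination (r * x + s) * him - (r * y) * hre
  have hdetR : (p * s - q * r : ℝ) = -1 := by exact_mod_cast hdet
  rw [hdetR] at key
  have hsq : 0 ≤ (r * x + s) ^ 2 + (r * y) ^ 2 := by positivity
  nlinarith [mul_nonneg hv0.le hsq]

/-! ### The lattice computation: `SL₂(ℤ)`-equivalent forms have equivalent ideals -/

section Lattice

variable {R : Type*} [CommRing R] [IsDomain R] [CharZero R] (b : Basis (Fin 2) ℤ R) (hb : b 0 = 1)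
  {t m : ℤ} (hω : b 1 * b 1 = (m : R) + (t : R) * b 1)

include hω in
/-- **`(A'') 𝔞_Q = (μ) 𝔞_{Q''}` for `Q'' = Q ∘ g⁻¹`.** Let `(1, ω)` be a `ℤ`-basis of the
domain `R`, `ω² = m + tω`, let `Q = (A, 2k − t, C)` have discriminant `t² + 4m`
(`AC = k² − tk − m`), and let `g = (p q; r s)`, `ps − qr = 1`. With
`A'' = As² − Bsr + Cr²`, `k'' = −Aqs + k(ps + qr) − tqr − Cpr` (so that
`B'' = 2k'' − t = −2Aqs + B(ps + qr) − 2Cpr` and `g · τ_Q = τ_{(A'', B'', C'')}`,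
`sl2_smul_heegnerTau`) and `μ = r(ω − k) + sA`:
`(A'') · (A, ω − k) = (μ) · (A'', ω − k'')` — the ideal-theoretic form of
`[1, gτ] = (rτ + s)⁻¹ [1, τ]` (Cox, (7.10); the four generators correspond under `g` and `g⁻¹`).
[cite: Cox2013, §7.B Thm. 7.7 (proof, (7.8)–(7.10))] -/
theorem sl2_formIdeal_eq {A C k p q r s A'' k'' : ℤ} (hn : A * C = k ^ 2 - t * k - m)
    (hdet : p * s - q * r = 1) (hA'' : A'' = A * s ^ 2 - (2 * k - t) * s * r + C * r ^ 2)
    (hk'' : k'' = -(A * q * s) + k * (p * s + q * r) - t * q * r - C * p * r) :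
    Ideal.span {(A'' : R)} * Ideal.span {(A : R), b 1 - k} =
      Ideal.span {(r : R) * (b 1 - k) + s * A} * Ideal.span {(A'' : R), b 1 - k''} := by
  subst hA'' hk''
  set η : R := b 1 - k with hη
  set η'' : R := b 1 - ((-(A * q * s) + k * (p * s + q * r) - t * q * r - C * p * r : ℤ) : R)
    with hη''
  set a'' : R := ((A * s ^ 2 - (2 * k - t) * s * r + C * r ^ 2 : ℤ) : R) with ha''
  set μ : R := (r : R) * η + s * A with hμ
  have hdet' : (p : R) * s - q * r = 1 := by exact_mod_cast hdet
  have hn' : (A : R) * C = (k : R) ^ 2 - t * k - m := by exact_mod_cast hn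
  -- the key identity `μ η'' = p (A'' η) + q (A'' A)`, checked after multiplying by `4`
  have hii : μ * η'' = (p : R) * (a'' * η) + q * (a'' * A) := by
    have h4 : (4 : R) * (μ * η'') = 4 * ((p : R) * (a'' * η) + q * (a'' * A)) := by
      rw [hμ, hη'', ha'', hη]
      push_cast
      linear_combination (-2 * (2 * s * A * b 1 - s * A * t - 2 * r * k * b 1 - r * k * t
        + r * t * b 1 + 2 * r * k ^ 2 - 2 * r * A * C : R)
        - 2 * t * (r * (b 1 - k) + s * A)) * hdet' + (4 * r : R) * hω + (4 * r : R) * hn'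
    exact mul_left_cancel₀ (by norm_num : (4 : R) ≠ 0) h4
  have hi : μ * a'' = (r : R) * (a'' * η) + s * (a'' * A) := by rw [hμ]; ring
  have hiii : a'' * η = (s : R) * (μ * η'') - q * (μ * a'') := by
    rw [hii, hi]; linear_combination (-(a'' * η)) * hdet'
  have hiv : a'' * A = -(r : R) * (μ * η'') + p * (μ * a'') := by
    rw [hii, hi]; linear_combination (-(a'' * A)) * hdet'
  rw [span_singleton_mul_span_pair, span_singleton_mul_span_pair]
  apply le_antisymm
  · rw [Ideal.span_le]
    rintro x (rfl | rfl)
    · rw [hiv]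
      exact Ideal.add_mem _ (Ideal.mul_mem_left _ _ (Ideal.subset_span (by simp)))
        (Ideal.mul_mem_left _ _ (Ideal.subset_span (by simp)))
    · rw [hiii]
      exact Ideal.sub_mem _ (Ideal.mul_mem_left _ _ (Ideal.subset_span (by simp)))
        (Ideal.mul_mem_left _ _ (Ideal.subset_span (by simp)))
  · rw [Ideal.span_le]
    rintro x (rfl | rfl)
    · rw [hi]
      exact Ideal.add_mem _ (Ideal.mul_mem_left _ _ (Ideal.subset_span (by simp)))
        (Ideal.mul_mem_left _ _ (Ideal.subset_span (by simp)))
    · rw [hii]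
      exact Ideal.add_mem _ (Ideal.mul_mem_left _ _ (Ideal.subset_span (by simp)))
        (Ideal.mul_mem_left _ _ (Ideal.subset_span (by simp)))

omit [IsDomain R] [CharZero R] in
include hb in
/-- `μ = r(ω − k) + sA ≠ 0` for `(r, s)` the bottom row of a matrix of determinant `1` and
`A ≠ 0`. [folklore] -/
theorem row_comb_ne_zero {A k p q r s : ℤ} (hA : A ≠ 0) (hdet : p * s - q * r = 1) :
    (r : R) * (b 1 - k) + s * A ≠ 0 := by
  intro h
  have h' : ((s * A - r * k : ℤ) : R) + (r : R) * b 1 = ((0 : ℤ) : R) + ((0 : ℤ) : R) * b 1 := by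
    push_cast
    linear_combination h
  obtain ⟨h1, h2⟩ := intCast_add_intCast_mul_inj b hb h'
  subst h2
  have hs : s = 0 := by
    rcases mul_eq_zero.mp (show s * A = 0 by simpa using h1) with hs | hs
    · exact hs
    · exact absurd hs hA
  subst hs
  simp at hdet

end Lattice

/-! ### `Γ₀(N)`-equivalent Heegner forms have equivalent ideals -/

/-- **Invariance of the ideal class under `Γ₀(N)` (indeed `SL₂(ℤ)`).** Let `(1, ω)` be an
integral basis of the quadratic field `K` with `ω² = m + tω` (`d_K = t² + 4m < 0`), and let
`Q = (A, B, C)`, `Q' = (A', B', C')` be positive definite forms of discriminant `t² + 4m` whose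
Heegner points are `Γ₀(N)`-equivalent (`IsGamma0Equiv N Q Q'`: `γ · τ_Q = τ_{Q'}`). Then the
ideals `𝔞_Q = (A, ω − (B + t)/2)` and `𝔞_{Q'}` satisfy `(x) 𝔞_Q = (y) 𝔞_{Q'}` for some non-zero
`x, y ∈ 𝓞 K`, i.e. have the same class (Gross 1984, §I.1; Cox, Thm. 7.7(ii): equivalent forms
give the same ideal class). Proof: `γ · τ_Q = τ_{Q''}` for the explicit form `Q'' = Q ∘ γ⁻¹`
(`sl2_smul_heegnerTau`), so `Q'' = Q'` (`heegnerForm_eq_of_heegnerTau_eq`), and `sl2_formIdeal_eq`.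
[cite: Gross1984, §I.1] -/
theorem exists_span_mul_formIdeal_eq_of_isGamma0Equiv {K : Type*} [Field K] [NumberField K]
    (b : Basis (Fin 2) ℤ (𝓞 K)) (hb : b 0 = 1) {t m : ℤ}
    (hω : b 1 * b 1 = (m : 𝓞 K) + (t : 𝓞 K) * b 1) (hneg : t ^ 2 + 4 * m < 0) {N : ℕ}
    {Q Q' : ℤ × ℤ × ℤ} (hA : 0 < Q.1) (hdisc : Q.2.1 ^ 2 - 4 * Q.1 * Q.2.2 = t ^ 2 + 4 * m)
    (hA' : 0 < Q'.1) (hdisc' : Q'.2.1 ^ 2 - 4 * Q'.1 * Q'.2.2 = t ^ 2 + 4 * m)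
    (h : IsGamma0Equiv N Q Q') :
    ∃ x y : 𝓞 K, x ≠ 0 ∧ y ≠ 0 ∧
      Ideal.span {x} * Ideal.span {(Q.1 : 𝓞 K), b 1 - (((Q.2.1 + t) / 2 : ℤ) : 𝓞 K)} =
        Ideal.span {y} * Ideal.span {(Q'.1 : 𝓞 K), b 1 - (((Q'.2.1 + t) / 2 : ℤ) : 𝓞 K)} := by
  obtain ⟨γ, hγ⟩ := h
  obtain ⟨A, B, C⟩ := Q
  obtain ⟨A', B', C'⟩ := Q'
  dsimp only at hA hdisc hA' hdisc' hγ ⊢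
  set g : SL(2, ℤ) := (γ : SL(2, ℤ)) with hg
  have hD : B ^ 2 - 4 * A * C < 0 := hdisc ▸ hneg
  have hsmul : g • heegnerTau (A, B, C) = heegnerTau (A', B', C') := by
    rw [← hγ, hg, Subgroup.smul_def]
  rw [sl2_smul_heegnerTau g hA hD] at hsmul
  set p : ℤ := g 0 0 with hp
  set q : ℤ := g 0 1 with hq
  set r : ℤ := g 1 0 with hr
  set s : ℤ := g 1 1 with hs
  have hdet : p * s - q * r = 1 := by
    have h := Matrix.det_fin_two (g : Matrix (Fin 2) (Fin 2) ℤ)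
    rw [g.det_coe] at h
    rw [hp, hq, hr, hs]
    linarith
  -- `Q'' = Q'`
  have hA'' : 0 < A * s ^ 2 - B * s * r + C * r ^ 2 := sl2_act_fst_pos g hA hD
  have hdisc'' := sl2_act_disc g A B C
  have hQ := heegnerForm_eq_of_heegnerTau_eq (Q := (_, _, _)) (Q' := (A', B', C')) hA''
    (by rw [hdisc'']; exact hD) hA' (by rw [hdisc'', hdisc, hdisc']) hsmul
  simp only [Prod.mk.injEq] at hQ
  obtain ⟨hA1, hB1, -⟩ := hQ
  -- `k`, `k''`
  set k : ℤ := (B + t) / 2 with hk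
  have h2k : 2 * k = B + t := two_mul_ediv_two_of_disc_eq hdisc
  have hn : A * C = k ^ 2 - t * k - m := norm_eq_of_disc_eq hdisc h2k
  set k'' : ℤ := -(A * q * s) + k * (p * s + q * r) - t * q * r - C * p * r with hk''
  have hk' : (B' + t) / 2 = k'' := by
    rw [← hB1]
    have : -(2 * A * q * s) + B * (p * s + q * r) - 2 * C * p * r + t = 2 * k'' := by
      rw [hk'']
      have hB : B = 2 * k - t := by linarith
      rw [hB]
      linear_combination (-t) * hdet
    omega
  refine ⟨(A' : 𝓞 K), (r : 𝓞 K) * (b 1 - k) + s * A, by exact_mod_cast hA'.ne',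
    row_comb_ne_zero b hb hA.ne' hdet, ?_⟩
  rw [hk', ← hA1]
  have hBk : B = 2 * k - t := by linarith
  rw [hBk]
  exact sl2_formIdeal_eq b hω hn hdet rfl hk''

end Literature.NumberTheory.EllipticCurves

end
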